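import Summits.Ventures.HodgeKum4.Invariants
import Literature.AlgebraicGeometry.Hyperkaehler.GeneralizedKummerTypeTranslationGroup
import HarnessLib

/-!
# Route KummerFixedLocus (`hodge-kum4`, rung H3) — the print input `KummerTranslationFrameExists`, CONDITIONAL closer

Seat p1.  Item stmt-Ventures-19268 (crux child of L1, route decl
`Summit.Ventures.HodgeKum4.Theses.KummerFixedLocus.KummerTranslationFrameExists` = the Statement-level
`Summit.Ventures.HodgeKum4.KummerTranslationFrameExists`: every smooth projective `Kum⁴`-type `X` carries a
Kummer translation frame) is a PRINT INPUT.  It follows BY UNFOLDING from the refereed Literature named fact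
`FloccariVaresco2024_autFixingH2H3_equiv_kumType` (`Γ(X) ≅ (ℤ/(n+1))⁴`; Boissière–Nieper-Wißkirchen–Sarti
2011, Hassett–Tschinkel 2013 Thm. 2.1, as stated by Floccari–Varesco, Math. Ann. 2025 §3) through the
literature seat's corollary `exists_frame_kum4Type` (p404953), whose conclusion is the body of
`IsKummerTranslationFrame X g` verbatim.  The theorem below takes that fact as a hypothesis — a
CONDITIONAL result (the gate records `conditional-result`; the item does not close as `proved` while the
printed fact is unproved in the tree); its conclusion is the Statement-level decl, of which the route decl
is the by-name alias (this file deliberately does not import the Theses module).  HONEST FRAMING: nothing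
here says `HC_Kum4Type` is proved.
-/

noncomputable section

namespace Summit.Ventures.HodgeKum4

open Literature.AlgebraicGeometry.Hyperkaehler (FloccariVaresco2024_autFixingH2H3_equiv_kumType)

/-- **Frame existence from print (item stmt-Ventures-19268, conditional on the refereed fact)**:
`FloccariVaresco2024_autFixingH2H3_equiv_kumType → KummerTranslationFrameExists` — the frame is the
inverse of an isomorphism `Γ(X) ≅ (ℤ/5)⁴` (`exists_frame_kum4Type`), read as morphisms `X ⟶ X`. -/
theorem kummerTranslationFrameExists_of_literature (h : FloccariVaresco2024_autFixingH2H3_equiv_kumType) :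
    Summit.Ventures.HodgeKum4.KummerTranslationFrameExists :=
  fun _ hX hK ↦ h.exists_frame_kum4Type hX hK

end Summit.Ventures.HodgeKum4

end
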